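import Summits.RiemannHypothesis.RiemannHypothesis.Theorems.Splittings.ZdLocalReferencePins
import HarnessLib

/-!
# What would decide the banked prime-pin scales: zero clusters versus the reference's speed (zd-neg g10 §2d)

Cell rh-split, seat rh-split-zd-neg g10 (brief sha16 f79c5f09d8bcb036), card `run/shared/lean/pub/rh-split/cards/SPLIT-zd-neg.md` GEN-10
(N65–N68, R57–R61, B11–B12 + SUPPLEMENT); source `HOME/rh-split-zd-neg/SketchG10.lean` v2 sha16 29368ce59f30369a (namespace `RhSplitZdNegG10`),
referee rh-split-ref-2 g0: GEN-10 REPLAY PASS on kernel v2 + CONTENT read-backs R1–R10 + LABELS N65–N68 UPHELD (2026-08-27T09:34:25Z, `INBOX.md`);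
lead rh-split-lead g3; CARVE MAP + CUT.md in `HOME/rh-split-zd-neg/carve-g10/`.  Deltas vs the source (CUT.md): namespace ↦ `…Splittings.<lane>`, the scratch
abbreviations `FIN` / `H₀` SPELLED OUT (`riemannHypothesisUpTo_platt_trudgian` / `3000175332800`), the §0/§1 frame decls CITED from the tree
(`Splittings.ZdReferencePinsFrame`: `RHAbove`, `rh_of_fin_of_rhAbove`, `rhAbove_of_rh`, `two_le_count_jump`, `zetaArgS_sub`) instead of restated,
`primesLE_mono` ↦ Mathlib `Nat.primesLE_mono`, `abs_sin_sub_sin_le` privatised, docstrings added to helper decls; decl text otherwise byte-verbatim.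

This file: §2d `primeLogSum` (`D_N = Σ_{p≤N} log p/√p`), `abs_primeSin_sub_le` (`P_N` is `D_N`-Lipschitz), `riemannSiegelTheta_sub_le` (θ is
`(½ log T + 2)`-Lipschitz on `[1, T]`), and the typed implication `not_primePin_of_cluster`: `k` zeros inside a window of length
`≤ π(k − 2r)/(½ log T + 2 + D_{⌊T^a⌋₊})` in `[T/2, T]` above every height refute `PrimePin a r H`. The cluster input is OPEN at every scale
(named missing input of census R60 (k2)); nothing here asserts it.

HONEST LABEL: «SPLITTING SEARCH over kernel-typed RH-EQUIVALENCES; a splitting A ∧ B ⟹ RH is CONDITIONAL bookkeeping unless A and B are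
both proved; nothing here bears on the truth of RH.»
-/

set_option linter.dupNamespace false

noncomputable section

open Filter Complex Metric Set
open scoped Real Topology

namespace Summit.RiemannHypothesis.RiemannHypothesis.Theorems.Splittings.ZdPrimePin

open Literature.NumberTheory.DiophantineGeometry Literature.NumberTheory.LFunctions
  Literature.Barriers.RiemannHypothesis MeasureTheory
open Summit.RiemannHypothesis.RiemannHypothesis.Theorems.Splittings.ZdReferencePins (RHAbove
  rh_of_fin_of_rhAbove rhAbove_of_rh two_le_count_jump zetaArgS_sub)
open Summit.RiemannHypothesis.RiemannHypothesis.Theorems.Splittings.ZdTwoHeightMeanSquare (primeSin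
  continuous_primeSin' im_sq_integral_ge primesLE_subset_Icc_sq sizes_aux intervalIntegrable_selbergE_sq)

/-! ## §2d What would decide the banked scales: zero clusters vs the reference's speed

The prime reference moves at speed `≤ π⁻¹ D_N`, `D_N = Σ_{p ≤ N} log p/√p` (`≍ √N = T^{a/2}`), and
`θ` at speed `≤ ½ log T + 2` on `[T/2, T]` (tree `abs_riemannSiegelThetaDeriv_sub_log_le`); so
`k` zeros (with multiplicity) inside `[t₁, t₂] ⊆ [T/2, T]` with
`(t₂ − t₁)(½ log T + 2 + D_N) ≤ π (k − 2r)` are incompatible with `PrimePin a r H`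
(`not_primePin_of_cluster`). For `r < 1` a close PAIR suffices, for `r = 1` a close TRIPLE. This is a
TYPED IMPLICATION: the cluster statement is the named missing input of census R60 (k2)
(heuristically supplied by pair correlation for `a < 2/3`, pairs; known at no scale). -/

/-- `D_N = Σ_{p ≤ N} log p / √p`: a Lipschitz constant for `P_N`. -/
def primeLogSum (N : ℕ) : ℝ := ∑ p ∈ Nat.primesLE N, Real.log p / Real.sqrt p

/-- `0 ≤ D_N`. -/
theorem primeLogSum_nonneg (N : ℕ) : 0 ≤ primeLogSum N := by
  unfold primeLogSum
  refine Finset.sum_nonneg fun p hp ↦ ?_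
  have hp' : p.Prime := (Nat.mem_primesLE.1 hp).2
  exact div_nonneg (Real.log_nonneg (by exact_mod_cast hp'.one_lt.le)) (Real.sqrt_nonneg _)

/-- `sin` is 1-Lipschitz (private copy; the tree has several namespaced ones). -/
private theorem abs_sin_sub_sin_le (x y : ℝ) : |Real.sin x - Real.sin y| ≤ |x - y| := by
  rw [Real.sin_sub_sin]
  calc |2 * Real.sin ((x - y) / 2) * Real.cos ((x + y) / 2)|
      = 2 * |Real.sin ((x - y) / 2)| * |Real.cos ((x + y) / 2)| := by
        rw [abs_mul, abs_mul, abs_two]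
    _ ≤ 2 * |(x - y) / 2| * 1 := by
        have h1 : |Real.sin ((x - y) / 2)| ≤ |(x - y) / 2| := Real.abs_sin_le_abs
        have h2 : |Real.cos ((x + y) / 2)| ≤ 1 := Real.abs_cos_le_one _
        exact mul_le_mul (mul_le_mul_of_nonneg_left h1 two_pos.le) h2 (abs_nonneg _)
          (by positivity)
    _ = |x - y| := by rw [abs_div, abs_two]; ring

/-- `|P_N(t₂) − P_N(t₁)| ≤ |t₂ − t₁| · D_N`. -/
theorem abs_primeSin_sub_le (N : ℕ) (t₁ t₂ : ℝ) :
    |primeSin N t₂ - primeSin N t₁| ≤ |t₂ - t₁| * primeLogSum N := by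
  unfold primeSin primeLogSum
  rw [← Finset.sum_sub_distrib, Finset.mul_sum]
  refine (Finset.abs_sum_le_sum_abs _ _).trans (Finset.sum_le_sum fun p hp ↦ ?_)
  have hp' : p.Prime := (Nat.mem_primesLE.1 hp).2
  have hp1 : (1 : ℝ) ≤ p := by exact_mod_cast hp'.one_lt.le
  have hlog : 0 ≤ Real.log p := Real.log_nonneg hp1
  have hsq : 0 < Real.sqrt p := Real.sqrt_pos.2 (by linarith)
  rw [← sub_div, abs_div, abs_of_pos hsq, mul_div_assoc', div_le_div_iff_of_pos_right hsq]
  calc |Real.sin (t₂ * Real.log p) - Real.sin (t₁ * Real.log p)|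
      ≤ |t₂ * Real.log p - t₁ * Real.log p| := abs_sin_sub_sin_le _ _
    _ = |t₂ - t₁| * Real.log p := by rw [← sub_mul, abs_mul, abs_of_nonneg hlog]

/-- `θ(t₂) − θ(t₁) ≤ (t₂ − t₁)(½ log T + 2)` for `1 ≤ t₁ ≤ t₂ ≤ T` (mean value theorem with the
tree's explicit `θ'` bound). -/
theorem riemannSiegelTheta_sub_le {t₁ t₂ T : ℝ} (h1 : 1 ≤ t₁) (h12 : t₁ ≤ t₂) (h2T : t₂ ≤ T) :
    riemannSiegelTheta t₂ - riemannSiegelTheta t₁ ≤ (Real.log T / 2 + 2) * (t₂ - t₁) := by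
  have hdiff : Differentiable ℝ riemannSiegelTheta :=
    fun t ↦ (hasDerivAt_riemannSiegelTheta_holds t).differentiableAt
  have key := (convex_Icc t₁ t₂).image_sub_le_mul_sub_of_deriv_le hdiff.continuous.continuousOn
    (hdiff.differentiableOn) (C := Real.log T / 2 + 2) ?_ t₁ (Set.left_mem_Icc.2 h12) t₂
    (Set.right_mem_Icc.2 h12) h12
  · simpa using key
  · intro x hx
    have hx' : x ∈ Set.Ioo t₁ t₂ := by simpa [interior_Icc] using hx
    have hx1 : 1 ≤ x := h1.trans hx'.1.le
    have hx0 : 0 < x := by linarith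
    have hxT : x ≤ T := hx'.2.le.trans h2T
    rw [(hasDerivAt_riemannSiegelTheta_holds x).deriv]
    have hb := (abs_le.1 (abs_riemannSiegelThetaDeriv_sub_log_le hx1)).2
    have hlog : Real.log (x / (2 * π)) ≤ Real.log T := by
      apply Real.log_le_log (by positivity)
      calc x / (2 * π) ≤ x / 1 := by
            apply div_le_div_of_nonneg_left hx0.le one_pos
            linarith [Real.pi_gt_three]
        _ ≤ T := by rw [div_one]; exact hxT
    have h2x : 2 / x ≤ 2 := by rw [div_le_iff₀ hx0]; linarith
    linarith

/-- **Typed kill of the banked scales.** If above every height some block `[T/2, T]` carries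
`k` zeros (with multiplicity, `N(t₂) − N(t₁) ≥ k`) inside an interval so short that neither `θ/π`
nor the prime reference can follow — `(t₂ − t₁)(½ log T + 2 + D_{⌊T^a⌋₊}) ≤ π (k − 2r)` — then
`PrimePin a r H` fails. -/
theorem not_primePin_of_cluster {a r H : ℝ} {k : ℕ}
    (hclus : ∀ H' : ℝ, ∃ T : ℝ, H' ≤ T ∧ ∃ t₁ t₂ : ℝ, T / 2 ≤ t₁ ∧ t₁ ≤ t₂ ∧ t₂ ≤ T ∧
      (t₂ - t₁) * (Real.log T / 2 + 2 + primeLogSum ⌊T ^ a⌋₊) ≤ π * (k - 2 * r) ∧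
      (k : ℝ) ≤ (zetaZeroCount t₂ : ℝ) - zetaZeroCount t₁) :
    ¬ PrimePin a r H := by
  intro hpin
  obtain ⟨T, hT, t₁, t₂, ht1, h12, ht2, hshort, hk⟩ := hclus (max H 2)
  have hTH : H ≤ T := (le_max_left _ _).trans hT
  have hT2 : 2 ≤ T := (le_max_right _ _).trans hT
  have h1 : 1 ≤ t₁ := by linarith
  set N := ⌊T ^ a⌋₊ with hN
  have hp1 := hpin T hTH t₁ ht1 (h12.trans ht2)
  have hp2 := hpin T hTH t₂ (ht1.trans h12) ht2
  have hS := zetaArgS_sub t₁ t₂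
  have hθ := riemannSiegelTheta_sub_le h1 h12 ht2
  have hP := abs_primeSin_sub_le N t₁ t₂
  rw [abs_of_nonneg (sub_nonneg.2 h12)] at hP
  have hπ : 0 < π := Real.pi_pos
  have hD := primeLogSum_nonneg N
  -- S t₂ − S t₁ ≥ k − (t₂−t₁)(log T/2 + 2)/π
  have hlow : (k : ℝ) - (Real.log T / 2 + 2) * (t₂ - t₁) / π ≤ zetaArgS t₂ - zetaArgS t₁ := by
    rw [hS]
    have : (riemannSiegelTheta t₂ - riemannSiegelTheta t₁) / π
        ≤ (Real.log T / 2 + 2) * (t₂ - t₁) / π := div_le_div_of_nonneg_right hθ hπ.le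
    linarith
  -- S t₂ − S t₁ < 2r + (t₂−t₁) D_N/π
  have hup : zetaArgS t₂ - zetaArgS t₁ < 2 * r + (t₂ - t₁) * primeLogSum N / π := by
    have e1 := (abs_lt.1 hp1).1
    have e2 := (abs_lt.1 hp2).2
    have e3 := (abs_le.1 hP).1
    have : π⁻¹ * primeSin N t₂ - π⁻¹ * primeSin N t₁ = (primeSin N t₂ - primeSin N t₁) / π := by
      rw [← mul_sub, inv_mul_eq_div]
    have e4 : -((t₂ - t₁) * primeLogSum N / π) ≤ (primeSin N t₂ - primeSin N t₁) / π := by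
      rw [← neg_div]; exact div_le_div_of_nonneg_right e3 hπ.le
    linarith
  -- combine: π(k − 2r) < (t₂−t₁)(log T/2 + 2 + D_N)
  have hcomb : π * (k - 2 * r) < (t₂ - t₁) * (Real.log T / 2 + 2 + primeLogSum N) := by
    have := hlow.trans_lt hup
    have e : (k : ℝ) - (Real.log T / 2 + 2) * (t₂ - t₁) / π - (2 * r + (t₂ - t₁) * primeLogSum N / π)
        = (π * (k - 2 * r) - (t₂ - t₁) * (Real.log T / 2 + 2 + primeLogSum N)) / π := by
      field_simp; ring
    have hneg : (k : ℝ) - (Real.log T / 2 + 2) * (t₂ - t₁) / π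
        - (2 * r + (t₂ - t₁) * primeLogSum N / π) < 0 := by linarith
    rw [e, div_neg_iff] at hneg
    rcases hneg with ⟨_, h⟩ | ⟨h, _⟩
    · linarith
    · linarith
  linarith

end Summit.RiemannHypothesis.RiemannHypothesis.Theorems.Splittings.ZdPrimePin

end
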